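import Mathlib.Algebra.Order.Interval.Basic
import Mathlib.Data.Rat.Cast.Order
import Mathlib.Algebra.Order.Floor.Ring
import Mathlib.Data.Real.Basic
import Literature.Analysis.ValidatedNumerics.IntervalEnclosure
import HarnessLib

-- provenance: harness21/H21/H21/Prelude/DiophValNum/Certificate.lean @ efa73f9 (interim HEAD d8f2665); M5 mechanical rewrite
/-!
# Certificate-checking interface (trunk DiophValNum / T-VALNUM, item C8)

This file is a **partial realisation** of the inventory notion `interval_arithmetic`: it provides
the *certificate layer* — the statement shape "checker accepts the certificate `c` ⇒ the claimed
bound holds" — on top of the rational interval enclosures of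
`Literature.Prelude.DiophValNum.IntervalEnclosure`, together with one small end-to-end computable
instance (polynomial expressions over a rational box). It is *not* a verified numerics engine.

## Contents

* `Literature.Verifier ι Claim`: a certificate format `Cert`, a Boolean checker `check : ι → Cert → Bool`
  and its soundness `check i c = true → Claim i`. This is the T-VALNUM statement shape: a
  numerical theorem "`Claim i`" is discharged by exhibiting a certificate accepted by a checker
  whose soundness has been proved once and for all. `Verifier.claim` extracts the claim;
  combinators `Verifier.ofDecidable`, `Verifier.comap`, `Verifier.weaken`, `Verifier.prod`.
* Worked instance: `Literature.Analysis.ValidatedNumerics.ArithExpr` (constants, variables, `+`, `-`, `*`, unary `-`), its real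
  semantics `ArithExpr.eval`, its computable rational interval semantics `ArithExpr.enclose`
  (Mathlib's exact interval `+`/`-`, the Moore product `NonemptyInterval.mooreMul`, each operation
  followed by outward rounding `NonemptyInterval.roundOut prec`), the inclusion theorem
  `ArithExpr.eval_mem_enclose`, the claim format `Literature.Analysis.ValidatedNumerics.BoundClaim` ("`expr ≤ bound` on the box"),
  and the verifier `Literature.Analysis.ValidatedNumerics.boundVerifier` whose certificate is just the working precision.
  Two closing `example`s show that the whole pipeline (including `roundOut`) computes inside the
  kernel (`decide +kernel`).

## The named-hypothesis pattern

Large computer-assisted results (numerical RH verification up to height `T`, Platt–Trudgian 2021;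
rigorous enclosures in PDE proofs) enter H21 as *named hypotheses*: a `def FooUpTo (T) : Prop`
plus, where a Lean checker is conceivable, an `abbrev FooVerifier := Verifier ℕ FooUpTo` and the
one-line extraction lemma `foo_of_check (V : FooVerifier) (h : V.check T c = true) : FooUpTo T`
(see `Literature.Prelude.DiophValNum.NamedHypotheses`). Downstream statements take `FooUpTo T` as an
explicit hypothesis; the day a verified checker exists, the hypothesis is discharged by
`V.claim c (by decide)` (or `by native_decide` at the user's discretion) without touching the
statements.

## Mathlib

Mathlib has no certificate/checker abstraction of this kind (searched: `Verifier`, `Certificate`,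
`checker` — only `Mathlib.Tactic.Polyrith`/`Positivity` extension machinery and `Decidable`).
`Verifier.ofDecidable` records that any decidable claim is trivially a verifier with `Unit`
certificates. Interval types and operations are Mathlib's `NonemptyInterval`
(`Mathlib/Order/Interval/Basic.lean`, `Mathlib/Algebra/Order/Interval/Basic.lean`).

## Design notes

* `Verifier` bundles the certificate *type* as a field (so `Verifier ι Claim : Type 1` for
  `ι : Type`); this keeps the statement shape `∀ V : Verifier ι Claim, V.check i c = true → Claim i`
  uniform across certificate formats, as in LeanCert's `Cert`/`verify` pairs.
* In `ArithExpr.enclose` the leaves (`const`, `var`) are *not* rounded (they are user data, usually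
  already dyadic); every arithmetic node is rounded outward to precision `prec`, so all computed
  endpoints have denominator dividing `2 ^ prec` (`NonemptyInterval.den_fst_roundOut_dvd`).
* Variables are indexed by `ℕ` and boxes are lists read with default `[0, 0]`
  (`BoundClaim.boxAt`), a documented junk value: a claim only constrains the variables its
  expression mentions, and `Holds` quantifies over the same `boxAt`, so no vacuity arises.

## References

* `alerad/LeanCert` (certified numerical bounds in Lean 4) — design reference for `Verifier`.
* G. Irving, `girving/interval` (Lean 4 verified interval arithmetic), 2023–24 — design reference.
* D. Platt, T. Trudgian, *The Riemann hypothesis is true up to `3 · 10¹²`*, Bull. LMS 53 (2021) —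
  the motivating named hypothesis.
* R. E. Moore, *Interval Analysis*, Prentice-Hall, 1966, Ch. 3 (inclusion property).
-/

universe u v

namespace Literature.Analysis.ValidatedNumerics

open NonemptyInterval

/-! ### Verifiers -/

/-- A **verifier** for a family of claims `Claim : ι → Prop`: a type of certificates `Cert`, a
Boolean `check`er, and a once-and-for-all soundness proof that an accepted certificate implies the
claim. This is the T-VALNUM statement shape "checker accepts `c` ⇒ bound holds"
(cf. `alerad/LeanCert`, `girving/interval`). [folklore] -/
structure Verifier (ι : Type u) (Claim : ι → Prop) : Type (max u (v + 1)) where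
  /-- The type of certificates. -/
  Cert : Type v
  /-- The (computable) certificate checker. -/
  check : ι → Cert → Bool
  /-- Soundness: an accepted certificate proves the claim. -/
  sound : ∀ ⦃i : ι⦄ ⦃c : Cert⦄, check i c = true → Claim i

namespace Verifier

variable {ι : Type u} {κ : Type*} {Claim Claim' : ι → Prop}

/-- Extracting a claim from a verifier and an accepted certificate (the intended use:
`V.claim c (by decide)`) (T-VALNUM statement shape; cf. `alerad/LeanCert`). [folklore] -/
theorem claim (V : Verifier ι Claim) {i : ι} (c : V.Cert) (h : V.check i c = true) : Claim i :=
  V.sound h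

/-- A decidable family of claims is a verifier with trivial certificates: the checker is `decide`
(cf. Mathlib's `decide` tactic). [folklore] -/
def ofDecidable (Claim : ι → Prop) [DecidablePred Claim] : Verifier ι Claim where
  Cert := Unit
  check i _ := decide (Claim i)
  sound _ _ h := of_decide_eq_true h

/-- The checker of `Verifier.ofDecidable` is `decide`. [folklore] -/
@[simp]
theorem ofDecidable_check (Claim : ι → Prop) [DecidablePred Claim] (i : ι) (c : Unit) :
    (ofDecidable Claim).check i c = decide (Claim i) := rfl

/-- Pulling a verifier back along a reindexing map `f : κ → ι`: certificates for `f k` are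
certificates for `k` (cf. `alerad/LeanCert`). [folklore] -/
def comap (V : Verifier ι Claim) (f : κ → ι) : Verifier κ (Claim ∘ f) where
  Cert := V.Cert
  check k c := V.check (f k) c
  sound _ _ h := V.sound h

/-- The checker of `V.comap f` at `k` is the checker of `V` at `f k`. [folklore] -/
@[simp]
theorem comap_check (V : Verifier ι Claim) (f : κ → ι) (k : κ) (c : V.Cert) :
    (V.comap f).check k c = V.check (f k) c := rfl

/-- Weakening the claims of a verifier along a pointwise implication (cf. `alerad/LeanCert`). [folklore] -/
def weaken (V : Verifier ι Claim) (h : ∀ i, Claim i → Claim' i) : Verifier ι Claim' where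
  Cert := V.Cert
  check := V.check
  sound i _ hc := h i (V.sound hc)

/-- Weakening does not change the checker. [folklore] -/
@[simp]
theorem weaken_check (V : Verifier ι Claim) (h : ∀ i, Claim i → Claim' i) (i : ι) (c : V.Cert) :
    (V.weaken h).check i c = V.check i c := rfl

/-- The product of two verifiers on the same index type verifies the conjunction of the claims;
a certificate is a pair of certificates and the checker runs both (cf. `alerad/LeanCert`). [folklore] -/
def prod {C₁ C₂ : ι → Prop} (V₁ : Verifier ι C₁) (V₂ : Verifier ι C₂) :
    Verifier ι (fun i ↦ C₁ i ∧ C₂ i) where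
  Cert := V₁.Cert × V₂.Cert
  check i c := V₁.check i c.1 && V₂.check i c.2
  sound _ _ h := by
    rw [Bool.and_eq_true] at h
    exact ⟨V₁.sound h.1, V₂.sound h.2⟩

/-- The checker of `V₁.prod V₂` is the conjunction of the two checkers. [folklore] -/
@[simp]
theorem prod_check {C₁ C₂ : ι → Prop} (V₁ : Verifier ι C₁) (V₂ : Verifier ι C₂) (i : ι)
    (c : V₁.Cert × V₂.Cert) : (V₁.prod V₂).check i c = (V₁.check i c.1 && V₂.check i c.2) := rfl

end Verifier

/-! ### Worked instance: polynomial expressions over a rational box -/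

/-- Arithmetic expressions in countably many real variables with rational constants: the term
language `q | xᵢ | e₁ + e₂ | e₁ - e₂ | e₁ * e₂ | -e` of the worked certificate instance
(cf. the expression languages of `alerad/LeanCert` and `girving/interval`). [folklore] -/
inductive ArithExpr : Type
  /-- A rational constant. -/
  | const (q : ℚ) : ArithExpr
  /-- The `i`-th variable. -/
  | var (i : ℕ) : ArithExpr
  /-- Sum. -/
  | add (e₁ e₂ : ArithExpr) : ArithExpr
  /-- Difference. -/
  | sub (e₁ e₂ : ArithExpr) : ArithExpr
  /-- Product. -/
  | mul (e₁ e₂ : ArithExpr) : ArithExpr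
  /-- Negation. -/
  | neg (e : ArithExpr) : ArithExpr
  deriving DecidableEq, Inhabited

namespace ArithExpr

/-- The real number denoted by an arithmetic expression at the point `x : ℕ → ℝ`
(standard semantics; Moore 1966, §3.1). [cite: Moore1966, §3.1] -/
noncomputable def eval (x : ℕ → ℝ) : ArithExpr → ℝ
  | const q => q
  | var i => x i
  | add e₁ e₂ => e₁.eval x + e₂.eval x
  | sub e₁ e₂ => e₁.eval x - e₂.eval x
  | mul e₁ e₂ => e₁.eval x * e₂.eval x
  | neg e => -e.eval x

/-- A constant evaluates to itself. [folklore] -/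
@[simp] theorem eval_const (x : ℕ → ℝ) (q : ℚ) : (const q).eval x = q := rfl
/-- A variable evaluates to its coordinate. [folklore] -/
@[simp] theorem eval_var (x : ℕ → ℝ) (i : ℕ) : (var i).eval x = x i := rfl
/-- `eval` of a sum. [folklore] -/
@[simp] theorem eval_add (x : ℕ → ℝ) (e₁ e₂ : ArithExpr) :
    (add e₁ e₂).eval x = e₁.eval x + e₂.eval x := rfl
/-- `eval` of a difference. [folklore] -/
@[simp] theorem eval_sub (x : ℕ → ℝ) (e₁ e₂ : ArithExpr) :
    (sub e₁ e₂).eval x = e₁.eval x - e₂.eval x := rfl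
/-- `eval` of a product. [folklore] -/
@[simp] theorem eval_mul (x : ℕ → ℝ) (e₁ e₂ : ArithExpr) :
    (mul e₁ e₂).eval x = e₁.eval x * e₂.eval x := rfl
/-- `eval` of a negation. [folklore] -/
@[simp] theorem eval_neg (x : ℕ → ℝ) (e : ArithExpr) : (neg e).eval x = -e.eval x := rfl

/-- The **natural interval extension** of an arithmetic expression on the box
`X : ℕ → NonemptyInterval ℚ`, computed in exact rational arithmetic with every arithmetic node
rounded outward to dyadic precision `prec`: constants are point intervals, variables are read off
`X`, `+`/`-`/unary `-` are Mathlib's exact interval operations, `*` is the Moore product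
`NonemptyInterval.mooreMul` (Moore 1966, §3.1–3.2; cf. `girving/interval`). Computable, and
reducible in the kernel (`decide`). [cite: Moore1966, §3.1–3.2] -/
def enclose (prec : ℕ) (X : ℕ → NonemptyInterval ℚ) : ArithExpr → NonemptyInterval ℚ
  | const q => pure q
  | var i => X i
  | add e₁ e₂ => (e₁.enclose prec X + e₂.enclose prec X).roundOut prec
  | sub e₁ e₂ => (e₁.enclose prec X - e₂.enclose prec X).roundOut prec
  | mul e₁ e₂ => ((e₁.enclose prec X).mooreMul (e₂.enclose prec X)).roundOut prec
  | neg e => (-e.enclose prec X).roundOut prec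

/-- **Inclusion property** of the natural interval extension: if every coordinate `x i` lies in
the box `X i`, then the value of `e` at `x` lies in `e.enclose prec X`
(Moore 1966, Theorem 3.1). [cite: Moore1966, Theorem 3.1] -/
theorem eval_mem_enclose {prec : ℕ} {X : ℕ → NonemptyInterval ℚ} {x : ℕ → ℝ}
    (hx : ∀ i, x i ∈ (X i).ratCast ℝ) (e : ArithExpr) :
    e.eval x ∈ (e.enclose prec X).ratCast ℝ := by
  induction e with
  | const q => rw [enclose, ratCast_pure]; exact mem_pure_self _
  | var i => exact hx i
  | add e₁ e₂ ih₁ ih₂ => exact mem_roundOut prec (isSoundFun₂_add ih₁ ih₂)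
  | sub e₁ e₂ ih₁ ih₂ => exact mem_roundOut prec (isSoundFun₂_sub ih₁ ih₂)
  | mul e₁ e₂ ih₁ ih₂ => exact mem_roundOut prec (isSoundFun₂_mooreMul ih₁ ih₂)
  | neg e ih => exact mem_roundOut prec (isSoundFun_neg ih)

/-- Consequence of the inclusion property used by the bound verifier: the value of `e` on the box
is at most the right endpoint of its enclosure (Moore 1966, Theorem 3.1). [cite: Moore1966, Theorem 3.1] -/
theorem eval_le_snd_enclose (prec : ℕ) {X : ℕ → NonemptyInterval ℚ} {x : ℕ → ℝ}
    (hx : ∀ i, x i ∈ (X i).ratCast ℝ) (e : ArithExpr) :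
    e.eval x ≤ ((e.enclose prec X).snd : ℝ) :=
  (mem_ratCast_iff.1 (eval_mem_enclose (prec := prec) hx e)).2

end ArithExpr

/-- A **bound claim**: the assertion that the expression `expr` is at most `bound` on the rational
box `box` (the `i`-th variable ranges over the `i`-th interval of the list, or over `[0, 0]` past
its end). The typical shape of an entry in a table of certified numerical inequalities
(cf. `alerad/LeanCert`). [folklore] -/
structure BoundClaim where
  /-- The expression to be bounded. -/
  expr : ArithExpr
  /-- The box: the `i`-th variable ranges over `box[i]` (default `[0, 0]`). -/
  box : List (NonemptyInterval ℚ)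
  /-- The claimed upper bound. -/
  bound : ℚ

namespace BoundClaim

/-- The interval of the `i`-th variable of a bound claim; the junk value `[0, 0]` past the end of
the list (documented in the module docstring). [folklore] -/
def boxAt (c : BoundClaim) (i : ℕ) : NonemptyInterval ℚ :=
  c.box.getD i (pure 0)

/-- The proposition asserted by a bound claim: for every real point `x` of the box,
`c.expr.eval x ≤ c.bound`. [folklore] -/
def Holds (c : BoundClaim) : Prop :=
  ∀ x : ℕ → ℝ, (∀ i, x i ∈ (c.boxAt i).ratCast ℝ) → c.expr.eval x ≤ c.bound

end BoundClaim

/-- The **bound verifier**: a certificate for a `BoundClaim` is a working precision `prec : ℕ`; the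
checker evaluates the natural interval extension of the expression on the box at that precision
and compares its right endpoint with the claimed bound; soundness is the inclusion property
`ArithExpr.eval_mem_enclose` (Moore 1966, Theorem 3.1; the T-VALNUM statement shape "checker
accepts `c` ⇒ bound holds", cf. `alerad/LeanCert`). [cite: Moore1966, Theorem 3.1] -/
def boundVerifier : Verifier BoundClaim BoundClaim.Holds where
  Cert := ℕ
  check c prec := decide ((c.expr.enclose prec c.boxAt).snd ≤ c.bound)
  sound c prec h _ hx :=
    (c.expr.eval_le_snd_enclose prec hx).trans (Rat.cast_le.2 (of_decide_eq_true h))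

/-- The checker of `boundVerifier`, unfolded. [folklore] -/
@[simp]
theorem boundVerifier_check (c : BoundClaim) (prec : ℕ) :
    boundVerifier.check c prec = decide ((c.expr.enclose prec c.boxAt).snd ≤ c.bound) := rfl

/-- **Soundness of the bound verifier**, in the T-VALNUM statement shape: if the checker accepts
the claim `c` at precision `prec`, then `c` holds (Moore 1966, Theorem 3.1). [cite: Moore1966, Theorem 3.1] -/
theorem BoundClaim.holds_of_check (c : BoundClaim) (prec : ℕ)
    (h : boundVerifier.check c prec = true) : c.Holds :=
  boundVerifier.claim prec h

/-- End-to-end example, computed in the kernel by `decide`: for `x ∈ [0, 1]`,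
`x * (1 - x) ≤ 1`, certified at precision `4` (the enclosure is `[0, 1] ·ₘ [0, 1] = [0, 1]`). -/
example : BoundClaim.Holds
    ⟨.mul (.var 0) (.sub (.const 1) (.var 0)), [⟨(0, 1), by decide⟩], 1⟩ :=
  BoundClaim.holds_of_check _ 4 (by decide +kernel)

/-- A second kernel example exercising the outward rounding: for `x ∈ [0, 1/3]`,
`x * (1 - x) ≤ 3/8` at precision `4` (`1 - x ∈ [2/3, 1]` rounds out to `[5/8, 1]`, the Moore
product `[0, 1/3]` rounds out to `[0, 6/16]`). `decide +kernel` is used because the elaborator's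
`Decidable` evaluation does not unfold the structure projections; the kernel does. -/
example : BoundClaim.Holds
    ⟨.mul (.var 0) (.sub (.const 1) (.var 0)), [⟨(0, 1 / 3), by decide +kernel⟩], 3 / 8⟩ :=
  BoundClaim.holds_of_check _ 4 (by decide +kernel)

end Literature.Analysis.ValidatedNumerics
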